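import Literature.MathematicalPhysics.QuantumLattice.HubbardTTPrimeThermalPressureCellRule
import Literature.MathematicalPhysics.QuantumLattice.HubbardTTPrimeThermalPressureDensityAnchors
import Mathlib.Analysis.SpecialFunctions.BinaryEntropy
import HarnessLib

/-!
# `T > 0` BOX WORDS for the 2D `t–t'` Hubbard model on the number `pressureTT'`: the density leg over a
# temperature × coupling cell and the thermal-energy words it feeds on `(β, U, t', n)` boxes — the
# composition theorems behind «box ⊂ union of certified cells ⇒ word» at `T > 0`

Family `hubbard` (topic `MathematicalPhysics/QuantumLattice`); stage S2 of the Hubbard material oracle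
(«certifier families: parameter BOXES, `t' ≠ 0`, `T > 0`», D-0096/D-0097; the `T` axis of the phase maps,
D-0098/D-0099). The `T = 0` composition layer is `HubbardTTPrimeBoxWordCovering` / `…AffineBoxWords`
(ground-state energy: jointly CONCAVE in `(t', U)`, CONVEX in `n`). At `T > 0` the structure flips and
gains a coordinate: the pressure `p(β; t, s, U; n) = pressureTT' β t s U n` (hubbard-box-p1,
`HubbardTTPrimeThermalPressureLimit`: the limit exists for `β ≥ 0`, `U ≥ 0`, `0 ≤ n < 2`) is jointly CONVEX
in the `β`-scaled couplings `(β, βs, βU)` (`convexOn_pressureTT'_one`, `pressureTT'_scale`), ANTITONE in `U`,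
and CONCAVE in `n` (`concaveOn_pressureTT'_density`, `HubbardTTPrimeThermalPressureDensity`). The single-
direction consequences are in the tree (p1's RECIPES R36–R44 state the complete box rule in prose); the
cell rule in `(β, s, U)` is `HubbardTTPrimeThermalPressureCellRule` (joint tangent floor from one anchor, Jensen
ceiling from the corners); this file adds the density leg and the energy words: the box rule as theorems, in the letters the `T > 0` producers use (`∀ s ∈ Icc, ∀ U ∈ Icc, …`,
torus limits `ω` of the canonical sector Gibbs states, `e_Φ(ω) = ω.meanEnergy (hubbardTTPrimeFermionInteraction t s U) 1`).
Everything is PROVED; no definition, no named fact, no number.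

* §4 THE DENSITY LEG ON BOXES: endpoint floors bind the slab (`le_pressureTT'_on_box_of_endpointFloors`,
  floors `W₁, W₂` any functions of `(β,s,U)`); corner ceilings that are affine-in-`n` majorants on the slab
  (secant extrapolations `pressureTT'_le_of_anchor_ceiling_floor_right/left`, supporting lines) give a
  constant ceiling on the 4-D box (`pressureTT'_le_on_box_of_cornerDensityMajorants`).
* §5 THERMAL-ENERGY WORDS FROM PRESSURE WORDS (number forms of the chords): cap from a floor and the EXACT
  hot anchor `p(0;n) = 2H_b(n/2)` (`meanEnergy_le_of_pressureFloor`: `e_Φ ≤ (2H_b(n/2) − W)/β`), cap from a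
  hot ceiling and a cold floor (`meanEnergy_le_of_hotCeiling_of_pressureFloor`), floor from a floor and a
  colder ceiling (`le_meanEnergy_of_pressureFloor_of_coldCeiling`); the box form of the first
  (`meanEnergy_le_on_box_of_pressureFloor`, hole side `n₂ ≤ 1`: `2H_b(m/2) ≤ 2H_b(n₂/2)`).
* §6 THE ASSEMBLED WORD (`meanEnergy_le_on_box_of_twoAnchors`): TWO anchors `(β₀; t,s₀,U₀; nᵢ)` at the
  density ends, each with a certified pressure floor `Wᵢ` and torus-limit brackets of `(e_Φ, K₂, D)`, give
  on the whole box `β ≥ β₀` (cell `T ≤ 1/β₀`) × `[s₁,s₂]` × `[U₁,U₂]` × `[n₁,n₂]` (`U₁ ≥ 0`, `0 ≤ n₁ ≤ n₂ ≤ 1`):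
  `e_Φ(ω) ≤ (2H_b(n₂/2) − min(T₁,T₂))/β`, `Tᵢ = Wᵢ − [(β−β₀)eᵢ⁺ + max(β(s−s₀)kᵢ^∓) + max(β(U−U₀)dᵢ^∓)]`
  — the joint tangents of `HubbardTTPrimeThermalPressureCellRule` at the two ends, §4, §5. The floor
  side of the thermal window on any box is the `T = 0` box floor (`HubbardTTPrimeThermalAnnexOfBoxWords`).

Reading for the first object (cuprate box `(8 ± ½, −¼ ± 1/20, 0.875 ± 0.01)` × `T ≤ t/4`): two anchors
`(β₀ = 4; 1, −¼, 8; nᵢ)`, `nᵢ ∈ {0.865, 0.885}`, each with a pressure floor, an energy cap and `K₂`/`D` brackets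
(kinematic or certified), give the whole-box thermal cap by ONE application of §6; the certificate-side
readers `TypeClassSidecarReader{TPrimeUBox,FillingBox}` (hubbard-downfold-unc-1 and unc-2) compose the same legs.

WHAT THIS IS NOT: a certificate or a number of record; a phase or `T_c` statement; a grand-canonical / KMS
statement; new anchors.

## Mathlib / tree search

`lean search 'twoAnchors|endpointFloors.*pressureTT|pressureTT.*Icc.*Icc.*Icc'`: nothing box-shaped on the number
(the certificate-side readers `TypeClassSidecarReaderTPrimeUBox` / `…FillingBox` compose cluster rows on
all tori). REUSED: `pressureTT'_le_on_cell_of_corners`, `pressureTT'_jointTangent_floor_of_le`, `le_of_convexComb_le`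
(`…CellRule`), `le_pressureTT'_of_endpoint_floors`, the chords `IsTorusLimitOfMixture.meanEnergy_hubbardTTPrime_le_binEntropy_sub_pressureTT'_div`
/ `…_le_pressureTT'_chord` / `…pressureTT'_chord_le_meanEnergy…`, `BoxCovering.exists_convexWeights_Icc`,
Mathlib `Real.binEntropy_strictMonoOn`.

## References

* R. B. Israel, *Convexity in the Theory of Lattice Gases* (1979). [cite: Israel1979, Thm. I.3.4] [cite: Israel1979, Lemma II.3.1]
* D. Ruelle, *Statistical Mechanics: Rigorous Results* (1969), §3.4. [cite: Ruelle1969, §3.4]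
* S. J. Gustafson, I. M. Sigal, *Mathematical Concepts of Quantum Mechanics* (2003), §18.3. [cite: GustafsonSigal2003, §18.3]
* E. H. Lieb, Adv. Math. 11 (1973) 267, §V (5.2)–(5.4). [cite: Lieb1973, §V (5.2)–(5.4)]
* A. Neumaier, Acta Numerica 13 (2004), §11. [cite: Neumaier2004CompleteSearch, §11]
-/

noncomputable section

namespace Literature.MathematicalPhysics.QuantumLattice

open Matrix Finset HubbardWave0 Literature.Probability.LatticeModels ThermodynamicLimit
open Literature.Computation.Certificates
open _root_.Filter
open scoped _root_.Topology ComplexOrder BigOperators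

namespace ThermodynamicLimit

/-! ### §4 The density leg on boxes and the `(β, U, t', n)` pressure words -/

section Density

variable {n₁ n₂ : ℝ} (hn₁ : 0 ≤ n₁) (hn₂ : n₂ < 2)
include hn₁ hn₂

/-- **Floor on a `(β, t', U, n)` box from floors at the two density ends** (`0 ≤ n₁`, `n₂ < 2`, `0 ≤ β₁`,
`0 ≤ U₁`): floors `W₁(β,s,U) ≤ p(·;n₁)`, `W₂(β,s,U) ≤ p(·;n₂)` on the `(β, s, U)` cell give
`min W₁ W₂ ≤ p(β;t,s,U;n)` for every `n ∈ [n₁, n₂]` (concavity in `n`: endpoints bind the slab).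
[cite: Ruelle1969, §3.4] -/
theorem le_pressureTT'_on_box_of_endpointFloors {β₁ β₂ s₁ s₂ U₁ U₂ : ℝ} (hβ₁ : 0 ≤ β₁) (hU₁ : 0 ≤ U₁)
    (t : ℝ) {W₁ W₂ : ℝ → ℝ → ℝ → ℝ}
    (hW₁ : ∀ β ∈ Set.Icc β₁ β₂, ∀ s ∈ Set.Icc s₁ s₂, ∀ U ∈ Set.Icc U₁ U₂, W₁ β s U ≤ pressureTT' β t s U n₁)
    (hW₂ : ∀ β ∈ Set.Icc β₁ β₂, ∀ s ∈ Set.Icc s₁ s₂, ∀ U ∈ Set.Icc U₁ U₂, W₂ β s U ≤ pressureTT' β t s U n₂) :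
    ∀ β ∈ Set.Icc β₁ β₂, ∀ s ∈ Set.Icc s₁ s₂, ∀ U ∈ Set.Icc U₁ U₂, ∀ m ∈ Set.Icc n₁ n₂,
      min (W₁ β s U) (W₂ β s U) ≤ pressureTT' β t s U m :=
  fun β hβ s hs U hU _ hm =>
    le_pressureTT'_of_endpoint_floors (hβ₁.trans hβ.1) t s (hU₁.trans hU.1) hn₁ hm.1 hm.2 hn₂
      (hW₁ β hβ s hs U hU) (hW₂ β hβ s hs U hU)

/-- **Ceiling on a `(β, t', U, n)` box from ceilings at the density ends that are AFFINE-in-`n` majorants**: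
if `p(·; m) ≤ A(β,s,U) + B(β,s,U)·m` for all `m ∈ [n₁, n₂]` at the eight `(β, s, U)`-corners — e.g. a secant
extrapolation `pressureTT'_le_of_anchor_ceiling_floor_right/left` or a supporting line — and the corner
values of `A + B m` are `≤ V` at `m = n₁` and `m = n₂`, then `p ≤ V` on the whole box (corner rule in
`(β, s, U)` at each fixed `m`, then the affine function of `m` is below `V` at both slab ends).
[cite: Ruelle1969, §3.4] [cite: Israel1979, Thm. I.3.4] -/
theorem pressureTT'_le_on_box_of_cornerDensityMajorants {β₁ β₂ s₁ s₂ U₁ U₂ : ℝ} (hβ₁ : 0 ≤ β₁)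
    (hU₁ : 0 ≤ U₁) (t : ℝ) {A B : ℝ → ℝ → ℝ → ℝ} {V : ℝ}
    (hAB : ∀ b ∈ ({β₁, β₂} : Set ℝ), ∀ s' ∈ ({s₁, s₂} : Set ℝ), ∀ u ∈ ({U₁, U₂} : Set ℝ),
      ∀ m ∈ Set.Icc n₁ n₂, pressureTT' b t s' u m ≤ A b s' u + B b s' u * m)
    (hV : ∀ b ∈ ({β₁, β₂} : Set ℝ), ∀ s' ∈ ({s₁, s₂} : Set ℝ), ∀ u ∈ ({U₁, U₂} : Set ℝ),
      A b s' u + B b s' u * n₁ ≤ V ∧ A b s' u + B b s' u * n₂ ≤ V) :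
    ∀ β ∈ Set.Icc β₁ β₂, ∀ s ∈ Set.Icc s₁ s₂, ∀ U ∈ Set.Icc U₁ U₂, ∀ m ∈ Set.Icc n₁ n₂,
      pressureTT' β t s U m ≤ V := by
  intro β hβ s hs U hU m hm
  refine pressureTT'_le_on_cell_of_corners (hn₁.trans hm.1) (hm.2.trans_lt hn₂) hβ₁ hU₁ t
    (fun b hb s' hs' u hu => ?_) β hβ s hs U hU
  obtain ⟨l, k, hl, hk, hlk, hc⟩ := BoxCovering.exists_convexWeights_Icc hm.1 hm.2
  obtain ⟨h1, h2⟩ := hV b hb s' hs' u hu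
  have haff : A b s' u + B b s' u * m = l * (A b s' u + B b s' u * n₁) + k * (A b s' u + B b s' u * n₂) := by
    rw [← hc]; linear_combination (-(A b s' u)) * hlk
  exact le_of_convexComb_le ((hAB b hb s' hs' u hu m hm).trans haff.le) hl hk hlk h1 h2

end Density

/-! ### §5 THERMAL-ENERGY words on `(β, U, t', n)` boxes from pressure words -/

section Energy

variable {n : ℝ} (hn0 : 0 ≤ n) (hn2 : n < 2)
include hn0 hn2

/-- **Energy cap from a pressure floor (exact hot anchor `β_h = 0`)**: `W ≤ p(β; t,s,U; n)` with `β > 0`,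
`U ≥ 0` gives `e_Φ(ω) ≤ (2·H_b(n/2) − W)/β` for every torus-limit Gibbs state at `(β, t, s, U, n)`.
[cite: Israel1979, Lemma II.3.1] -/
theorem meanEnergy_le_of_pressureFloor (t s : ℝ) {U : ℝ} (hU : 0 ≤ U) {β : ℝ} (hβ : 0 < β) {W : ℝ}
    (hW : W ≤ pressureTT' β t s U n) :
    ∀ (ω : InfVolFermionState 2) (Ls : ℕ → ℕ), Tendsto Ls atTop atTop →
      ω.IsTorusLimitOfMixture (sectorGibbsCount n) (fun L => sectorGibbsWeightTT' β t s U n L)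
        (fun L => sectorGibbsVectorTT' t s U n L) Ls →
      ω.meanEnergy (hubbardTTPrimeFermionInteraction t s U) 1 ≤ (2 * Real.binEntropy (n / 2) - W) / β := by
  intro ω Ls hLs h
  refine (h.meanEnergy_hubbardTTPrime_le_binEntropy_sub_pressureTT'_div hU hn0 hn2 hLs hβ).trans ?_
  exact div_le_div_of_nonneg_right (by linarith) hβ.le

/-- **Energy cap from a hot ceiling and a cold floor (hot chord)**: `p(β_h) ≤ P`, `W ≤ p(β)`,
`0 < β_h < β` ⇒ `e_Φ(ω) ≤ (P − W)/(β − β_h)` for every torus-limit Gibbs state at `β`.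
[cite: Israel1979, Lemma II.3.1] -/
theorem meanEnergy_le_of_hotCeiling_of_pressureFloor (t s : ℝ) {U : ℝ} (hU : 0 ≤ U) {βh β : ℝ}
    (hβh : 0 < βh) (hlt : βh < β) {P W : ℝ} (hP : pressureTT' βh t s U n ≤ P) (hW : W ≤ pressureTT' β t s U n) :
    ∀ (ω : InfVolFermionState 2) (Ls : ℕ → ℕ), Tendsto Ls atTop atTop →
      ω.IsTorusLimitOfMixture (sectorGibbsCount n) (fun L => sectorGibbsWeightTT' β t s U n L)
        (fun L => sectorGibbsVectorTT' t s U n L) Ls →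
      ω.meanEnergy (hubbardTTPrimeFermionInteraction t s U) 1 ≤ (P - W) / (β - βh) := by
  intro ω Ls hLs h
  refine (h.meanEnergy_hubbardTTPrime_le_pressureTT'_chord hU hn0 hn2 hLs hβh hlt).trans ?_
  exact div_le_div_of_nonneg_right (by linarith) (by linarith)

/-- **Energy floor from a floor at `β` and a colder ceiling (cold chord)**: `W ≤ p(β)`, `p(β_c) ≤ P`,
`0 < β < β_c` ⇒ `(W − P)/(β_c − β) ≤ e_Φ(ω)`. [cite: Israel1979, Lemma II.3.1] -/
theorem le_meanEnergy_of_pressureFloor_of_coldCeiling (t s : ℝ) {U : ℝ} (hU : 0 ≤ U) {β βc : ℝ}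
    (hβ : 0 < β) (hlt : β < βc) {W P : ℝ} (hW : W ≤ pressureTT' β t s U n) (hP : pressureTT' βc t s U n ≤ P) :
    ∀ (ω : InfVolFermionState 2) (Ls : ℕ → ℕ), Tendsto Ls atTop atTop →
      ω.IsTorusLimitOfMixture (sectorGibbsCount n) (fun L => sectorGibbsWeightTT' β t s U n L)
        (fun L => sectorGibbsVectorTT' t s U n L) Ls →
      (W - P) / (βc - β) ≤ ω.meanEnergy (hubbardTTPrimeFermionInteraction t s U) 1 := by
  intro ω Ls hLs h
  refine le_trans ?_ (h.pressureTT'_chord_le_meanEnergy_hubbardTTPrime hU hn0 hn2 hLs hβ hlt)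
  exact div_le_div_of_nonneg_right (by linarith) (by linarith)

end Energy

section EnergyBox

/-- **THERMAL-ENERGY CAP on a `(β, U, t', n)` box from a pressure-floor word** (`0 < β₁`, `0 ≤ U₁`,
`0 ≤ n₁`, `n₂ ≤ 1`): a floor `W(β,s,U,m) ≤ p(β;t,s,U;m)` on the box gives, for every torus-limit Gibbs
state at every point of the box, `e_Φ(ω) ≤ (2·H_b(n₂/2) − W(β,s,U,m))/β` (exact hot anchor `p(0) = 2H_b(m/2)
≤ 2H_b(n₂/2)` on the hole side). [cite: Israel1979, Lemma II.3.1] [cite: Ruelle1969, §3.4] -/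
theorem meanEnergy_le_on_box_of_pressureFloor {β₁ β₂ s₁ s₂ U₁ U₂ n₁ n₂ : ℝ} (hβ₁ : 0 < β₁) (hU₁ : 0 ≤ U₁)
    (hn₁ : 0 ≤ n₁) (hn₂ : n₂ ≤ 1) (t : ℝ) {W : ℝ → ℝ → ℝ → ℝ → ℝ}
    (hW : ∀ β ∈ Set.Icc β₁ β₂, ∀ s ∈ Set.Icc s₁ s₂, ∀ U ∈ Set.Icc U₁ U₂, ∀ m ∈ Set.Icc n₁ n₂,
      W β s U m ≤ pressureTT' β t s U m) :
    ∀ β ∈ Set.Icc β₁ β₂, ∀ s ∈ Set.Icc s₁ s₂, ∀ U ∈ Set.Icc U₁ U₂, ∀ m ∈ Set.Icc n₁ n₂,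
      ∀ (ω : InfVolFermionState 2) (Ls : ℕ → ℕ), Tendsto Ls atTop atTop →
      ω.IsTorusLimitOfMixture (sectorGibbsCount m) (fun L => sectorGibbsWeightTT' β t s U m L)
        (fun L => sectorGibbsVectorTT' t s U m L) Ls →
      ω.meanEnergy (hubbardTTPrimeFermionInteraction t s U) 1 ≤ (2 * Real.binEntropy (n₂ / 2) - W β s U m) / β := by
  intro β hβ s hs U hU m hm ω Ls hLs h
  have hβ0 : 0 < β := hβ₁.trans_le hβ.1
  have hcap := meanEnergy_le_of_pressureFloor (hn₁.trans hm.1) (by linarith [hm.2]) t s (hU₁.trans hU.1) hβ0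
    (hW β hβ s hs U hU m hm) ω Ls hLs h
  refine hcap.trans (div_le_div_of_nonneg_right ?_ hβ0.le)
  have hmono : Real.binEntropy (m / 2) ≤ Real.binEntropy (n₂ / 2) :=
    Real.binEntropy_strictMonoOn.monotoneOn ⟨by linarith [hm.1], by norm_num; linarith [hm.2]⟩
      ⟨by linarith [hm.1, hm.2], by norm_num; linarith⟩ (by linarith [hm.2])
  linarith

end EnergyBox

/-! ### §6 THE ASSEMBLED WORD: a thermal-energy cap on a `(T ≤ 1/β₀) × [s₁,s₂] × [U₁,U₂] × [n₁,n₂]` box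
from TWO anchors (one per density end) -/

section Assembled

variable {n₁ n₂ : ℝ} (hn₁ : 0 ≤ n₁) (hn₁₂ : n₁ ≤ n₂) (hn₂ : n₂ ≤ 1)
include hn₁ hn₁₂ hn₂

/-- **THE `T > 0` BOX WORD FROM TWO ANCHORS.** Data at the two anchors `(β₀; t, s₀, U₀; nᵢ)`, `i = 1, 2`
(`β₀ > 0`, `U₀ ≥ 0`, `0 ≤ n₁ ≤ n₂ ≤ 1`): a certified pressure floor `Wᵢ ≤ p(β₀;t,s₀,U₀;nᵢ)` and, for every
torus-limit Gibbs state there, a thermal energy window `[eᵢ⁻, eᵢ⁺]`, a diagonal-kinetic window `[kᵢ⁻, kᵢ⁺]` and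
a double-occupancy window `[dᵢ⁻, dᵢ⁺]`. Then on the whole box `β ≥ β₀` (the cell `T ≤ 1/β₀`),
`s ∈ [s₁,s₂]`, `U ∈ [U₁,U₂]` (`U₁ ≥ 0`), `m ∈ [n₁,n₂]`, every torus-limit Gibbs state satisfies
`e_Φ(ω) ≤ (2·H_b(n₂/2) − min(T₁, T₂))/β`,
`Tᵢ = Wᵢ − [(β−β₀)eᵢ⁺ + max(β(s−s₀)kᵢ^∓) + max(β(U−U₀)dᵢ^∓)]`
(joint tangent floors at the two density ends, concavity in `n`, exact hot anchor `p(0;m) = 2H_b(m/2) ≤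
2H_b(n₂/2)`). [cite: Israel1979, Lemma II.3.1] [cite: Israel1979, Thm. I.3.4] [cite: Lieb1973, §V (5.2)–(5.4)]
[cite: Ruelle1969, §3.4] -/
theorem meanEnergy_le_on_box_of_twoAnchors {β₀ : ℝ} (hβ₀ : 0 < β₀) (t : ℝ) {s₀ U₀ : ℝ} (hU₀ : 0 ≤ U₀)
    {s₁ s₂ U₁ U₂ : ℝ} (hU₁ : 0 ≤ U₁)
    {W₁ e₁lo e₁hi k₁lo k₁hi d₁lo d₁hi W₂ e₂lo e₂hi k₂lo k₂hi d₂lo d₂hi : ℝ}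
    (hW₁ : W₁ ≤ pressureTT' β₀ t s₀ U₀ n₁) (hW₂ : W₂ ≤ pressureTT' β₀ t s₀ U₀ n₂)
    (he₁ : ∀ (ω : InfVolFermionState 2) (Ls : ℕ → ℕ), Tendsto Ls atTop atTop →
      ω.IsTorusLimitOfMixture (sectorGibbsCount n₁) (fun L => sectorGibbsWeightTT' β₀ t s₀ U₀ n₁ L)
        (fun L => sectorGibbsVectorTT' t s₀ U₀ n₁ L) Ls →
      e₁lo ≤ ω.meanEnergy (hubbardTTPrimeFermionInteraction t s₀ U₀) 1 ∧
        ω.meanEnergy (hubbardTTPrimeFermionInteraction t s₀ U₀) 1 ≤ e₁hi)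
    (hk₁ : ∀ (ω : InfVolFermionState 2) (Ls : ℕ → ℕ), Tendsto Ls atTop atTop →
      ω.IsTorusLimitOfMixture (sectorGibbsCount n₁) (fun L => sectorGibbsWeightTT' β₀ t s₀ U₀ n₁ L)
        (fun L => sectorGibbsVectorTT' t s₀ U₀ n₁ L) Ls →
      k₁lo ≤ ω.meanEnergy (hubbardTTPrimeFermionInteraction 0 1 0) 1 ∧
        ω.meanEnergy (hubbardTTPrimeFermionInteraction 0 1 0) 1 ≤ k₁hi)
    (hd₁ : ∀ (ω : InfVolFermionState 2) (Ls : ℕ → ℕ), Tendsto Ls atTop atTop →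
      ω.IsTorusLimitOfMixture (sectorGibbsCount n₁) (fun L => sectorGibbsWeightTT' β₀ t s₀ U₀ n₁ L)
        (fun L => sectorGibbsVectorTT' t s₀ U₀ n₁ L) Ls →
      d₁lo ≤ ω.meanEnergy (hubbardTTPrimeFermionInteraction 0 0 1) 1 ∧
        ω.meanEnergy (hubbardTTPrimeFermionInteraction 0 0 1) 1 ≤ d₁hi)
    (he₂ : ∀ (ω : InfVolFermionState 2) (Ls : ℕ → ℕ), Tendsto Ls atTop atTop →
      ω.IsTorusLimitOfMixture (sectorGibbsCount n₂) (fun L => sectorGibbsWeightTT' β₀ t s₀ U₀ n₂ L)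
        (fun L => sectorGibbsVectorTT' t s₀ U₀ n₂ L) Ls →
      e₂lo ≤ ω.meanEnergy (hubbardTTPrimeFermionInteraction t s₀ U₀) 1 ∧
        ω.meanEnergy (hubbardTTPrimeFermionInteraction t s₀ U₀) 1 ≤ e₂hi)
    (hk₂ : ∀ (ω : InfVolFermionState 2) (Ls : ℕ → ℕ), Tendsto Ls atTop atTop →
      ω.IsTorusLimitOfMixture (sectorGibbsCount n₂) (fun L => sectorGibbsWeightTT' β₀ t s₀ U₀ n₂ L)
        (fun L => sectorGibbsVectorTT' t s₀ U₀ n₂ L) Ls →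
      k₂lo ≤ ω.meanEnergy (hubbardTTPrimeFermionInteraction 0 1 0) 1 ∧
        ω.meanEnergy (hubbardTTPrimeFermionInteraction 0 1 0) 1 ≤ k₂hi)
    (hd₂ : ∀ (ω : InfVolFermionState 2) (Ls : ℕ → ℕ), Tendsto Ls atTop atTop →
      ω.IsTorusLimitOfMixture (sectorGibbsCount n₂) (fun L => sectorGibbsWeightTT' β₀ t s₀ U₀ n₂ L)
        (fun L => sectorGibbsVectorTT' t s₀ U₀ n₂ L) Ls →
      d₂lo ≤ ω.meanEnergy (hubbardTTPrimeFermionInteraction 0 0 1) 1 ∧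
        ω.meanEnergy (hubbardTTPrimeFermionInteraction 0 0 1) 1 ≤ d₂hi) :
    ∀ β : ℝ, β₀ ≤ β → ∀ s ∈ Set.Icc s₁ s₂, ∀ U ∈ Set.Icc U₁ U₂, ∀ m ∈ Set.Icc n₁ n₂,
      ∀ (ω : InfVolFermionState 2) (Ls : ℕ → ℕ), Tendsto Ls atTop atTop →
      ω.IsTorusLimitOfMixture (sectorGibbsCount m) (fun L => sectorGibbsWeightTT' β t s U m L)
        (fun L => sectorGibbsVectorTT' t s U m L) Ls →
      ω.meanEnergy (hubbardTTPrimeFermionInteraction t s U) 1 ≤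
        (2 * Real.binEntropy (n₂ / 2) -
          min (W₁ - ((β - β₀) * e₁hi + max (β * (s - s₀) * k₁lo) (β * (s - s₀) * k₁hi) +
                max (β * (U - U₀) * d₁lo) (β * (U - U₀) * d₁hi)))
              (W₂ - ((β - β₀) * e₂hi + max (β * (s - s₀) * k₂lo) (β * (s - s₀) * k₂hi) +
                max (β * (U - U₀) * d₂lo) (β * (U - U₀) * d₂hi)))) / β := by
  intro β hβ s _ U hU m hm ω Ls hLs h
  have hβpos : 0 < β := hβ₀.trans_le hβ
  have hU0 : 0 ≤ U := hU₁.trans hU.1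
  have hn₁2 : n₁ < 2 := by linarith
  have hn₂0 : 0 ≤ n₂ := hn₁.trans hn₁₂
  have hn₂2 : n₂ < 2 := by linarith
  -- joint tangent floors at the two density ends, read at the target `(β, s, U)`
  have hT₁ := pressureTT'_jointTangent_floor_of_le hn₁ hn₁2 hβ₀.le hβ t (s := s) hU₀ hU0 he₁ hk₁ hd₁
  have hT₂ := pressureTT'_jointTangent_floor_of_le hn₂0 hn₂2 hβ₀.le hβ t (s := s) hU₀ hU0 he₂ hk₂ hd₂
  -- concavity in the density binds the slab by its two ends
  have hT₁' : W₁ - ((β - β₀) * e₁hi + max (β * (s - s₀) * k₁lo) (β * (s - s₀) * k₁hi) +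
      max (β * (U - U₀) * d₁lo) (β * (U - U₀) * d₁hi)) ≤ pressureTT' β t s U n₁ := by linarith
  have hT₂' : W₂ - ((β - β₀) * e₂hi + max (β * (s - s₀) * k₂lo) (β * (s - s₀) * k₂hi) +
      max (β * (U - U₀) * d₂lo) (β * (U - U₀) * d₂hi)) ≤ pressureTT' β t s U n₂ := by linarith
  have hfloor := le_pressureTT'_of_endpoint_floors hβpos.le t s hU0 hn₁ hm.1 hm.2 hn₂2 hT₁' hT₂'
  -- the exact hot anchor `p(0; m) = 2 H_b(m/2) ≤ 2 H_b(n₂/2)`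
  have hcap := meanEnergy_le_of_pressureFloor (hn₁.trans hm.1) (by linarith [hm.2]) t s hU0 hβpos hfloor ω Ls hLs h
  refine hcap.trans (div_le_div_of_nonneg_right ?_ hβpos.le)
  have hmono : Real.binEntropy (m / 2) ≤ Real.binEntropy (n₂ / 2) :=
    Real.binEntropy_strictMonoOn.monotoneOn ⟨by linarith [hm.1], by norm_num; linarith [hm.2]⟩
      ⟨by linarith, by norm_num; linarith⟩ (by linarith [hm.2])
  linarith

end Assembled

end ThermodynamicLimit

end Literature.MathematicalPhysics.QuantumLattice

end
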